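import Literature.AnabelianGeometry.AbsoluteAnabelian.AbsTopII.InertiaGroups
import Literature.AnabelianGeometry.AbsoluteAnabelian.AbsTopII.InertiaDecompositionProofs

/-!
# [AbsTopII] Prop 1.3 (i), (ii), (iii) as typed: the universal closures are FALSE (schema certificates)

S. Mochizuki, *Topics in Absolute Anabelian Geometry II* [AbsTopII] (bib `MochizukiAbsTopII2013`;
locators = PDF pages of the kurims manuscript `paper:url-585b8d0ad0d9`), §1, Proposition 1.3 (i),
(ii), (iii) p. 11.  abc-iut-L4-t6 typed these clauses (FACT-LIST rows F-0297 `Prop_1_3_i`, F-0298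
`Prop_1_3_ii`, F-0299 `Prop_1_3_iii'`) as PREDICATES `X.Prop_1_3_…` on ABSTRACT DPSC data
`X : DPSCIndexData` (`AbsTopII/InertiaGroups.lean`, p405221): the profinite group `Π_H`, its
subgroups `Π_𝔾 ⊆ Π_I`, the chosen verticial / edge-like subgroups and the set of primes `Σ` are free
data; print asserts the clauses for the data ARISING FROM A STABLE LOG CURVE over a log point
(Def 1.2 (ii) p. 10), which the abstract structure does not record.

This proof-only file (no definitions) records the kernel facts that settle the SCHEMA question for
the three rows (cell rule R5: "a universal closure of a schema row is not a fact"):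

* `DPSCIndexData.not_prop_1_3_i_of_finite`, `not_prop_1_3_ii_of_finite`,
  `not_prop_1_3_iii'_of_finite` — each clause contains "`≅ Ẑ^Σ`" (`IsFreeProSigmaCyclic Σ _`) for
  some subgroup (`I_e` of a cusp; the two factors of `I_e ≅ Ẑ^Σ × Ẑ^Σ` of a node; `I_v` of a
  vertex), and a free pro-`Σ`-cyclic group is infinite (`Σ` is a nonempty set of primes by the
  `DPSCIndexData` axioms); so the clause FAILS at any data whose relevant subgroup is finite;
* `DPSCIndexData.exists_finite` — such data exist (the one-point profinite group with one vertex,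
  one node, one cusp, `Σ = {2}`);
* `DPSCIndexData.not_forall_prop_1_3_i`, `not_forall_prop_1_3_ii`, `not_forall_prop_1_3_iii'` —
  hence the universal closures `∀ X, X.Prop_1_3_…` are false: the rows are consumable only BY NAME
  at given data (as abc-iut-L4-t6's conditional closers do: `prop_1_3_iii'_of_inputs`,
  `prop13vii_of_prop_1_3_ii`, `prop13ix_of_prop_1_3_i_ii`), never as closed facts.

Nothing here says anything about the printed Proposition (whose data are geometric); it only
certifies that the typed predicates are genuinely data-dependent.
HONEST FRAMING: typed ≠ proved; no side is taken on [IUTchIII] Cor 3.12.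
-/

namespace Literature.AnabelianGeometry.AbsoluteAnabelian.AbsTopII.DPSCIndexData

universe u

variable (X : DPSCIndexData.{u})

/-! ## The `Ẑ^Σ`-clauses fail at finite subgroups -/

/-- **(i) fails at a finite cuspidal subgroup.** If some cusp `e` has FINITE `I_e = Π_e`, then
`X.Prop_1_3_i` ("`I_e ≅ Ẑ^Σ`") is false: a free pro-`Σ`-cyclic group is infinite, `Σ` containing a
prime. [cite: MochizukiAbsTopII2013, Prop 1.3 (i) p.11] -/
theorem not_prop_1_3_i_of_finite (e : X.Cusp) [Finite ↥(X.IvCusp e)] :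
    ¬ (Literature.AnabelianGeometry.AbsoluteAnabelian.AbsTopII.DPSCIndexData.Prop_1_3_i X) := by
  obtain ⟨⟨p, hp⟩, hprime⟩ := X.sigma_prime
  intro h
  exact ((h e).infinite (hprime p hp) hp).not_finite inferInstance

/-- **(ii) fails when `Π_H` is finite (and a node exists).** The clause "`I_e ≅ Ẑ^Σ × Ẑ^Σ`" of
`X.Prop_1_3_ii` provides a free pro-`Σ`-cyclic (hence infinite) subgroup `A ≤ Π_H`.
[cite: MochizukiAbsTopII2013, Prop 1.3 (ii) p.11] -/
theorem not_prop_1_3_ii_of_finite (e : X.Node) [Finite X.PiH] :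
    ¬ (Literature.AnabelianGeometry.AbsoluteAnabelian.AbsTopII.DPSCIndexData.Prop_1_3_ii X) := by
  obtain ⟨⟨p, hp⟩, hprime⟩ := X.sigma_prime
  intro h
  obtain ⟨-, ⟨A, B, -, -, hA, -, -⟩, -⟩ := h e
  exact (hA.infinite (hprime p hp) hp).not_finite inferInstance

/-- **(iii) fails at a finite verticial inertia group.** If some vertex `v` has FINITE
`I_v = Z_{Π_I}(Π_v)`, then `X.Prop_1_3_iii'` ("`I_v ≅ Ẑ^Σ`") is false (abc-iut-L4-t6's
`infinite_Iv_of_prop_1_3_iii'`). [cite: MochizukiAbsTopII2013, Prop 1.3 (iii) p.11] -/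
theorem not_prop_1_3_iii'_of_finite (v : X.Vert) [Finite ↥(X.Iv v)] :
    ¬ (Literature.AnabelianGeometry.AbsoluteAnabelian.AbsTopII.DPSCIndexData.Prop_1_3_iii' X) :=
  fun h => (X.infinite_Iv_of_prop_1_3_iii' h v).not_finite inferInstance

/-! ## Degenerate data exist -/

/-- **Finite DPSC data exist**: the one-point profinite group `Π_H = Π_I = Π_𝔾 = {1}` with one
vertex, one node, one cusp (all chosen subgroups `= Π_𝔾`), `Σ = {2}`, `i^Σ_e = 1`, satisfies every
axiom of the abstract structure `DPSCIndexData` (which records no geometry).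
[cite: MochizukiAbsTopII2013, Def 1.2 (ii) p.10] -/
theorem exists_finite :
    ∃ X : DPSCIndexData.{u}, Finite X.PiH ∧ Nonempty X.Vert ∧ Nonempty X.Node ∧ Nonempty X.Cusp := by
  haveI : IsTopologicalGroup PUnit.{u + 1} :=
    { continuous_mul := continuous_of_discreteTopology
      continuous_inv := continuous_of_discreteTopology }
  refine ⟨{ PiH := ProfiniteGrp.of PUnit.{u + 1}
            PiG := ⊤
            normal_PiG := inferInstance
            isClosed_PiG := by rw [Subgroup.coe_top]; exact isClosed_univ
            PiI := ⊤
            PiG_le_PiI := le_rfl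
            normal_PiI := inferInstance
            Vert := PUnit.{u + 1}
            Node := PUnit.{u + 1}
            Cusp := PUnit.{u + 1}
            vertSub := fun _ => ⊤
            vertSub_le := fun _ => le_rfl
            nodeSub := fun _ => ⊤
            nodeSub_le := fun _ => le_rfl
            cuspSub := fun _ => ⊤
            cuspSub_le := fun _ => le_rfl
            nodeAbuts := fun _ _ => True
            cuspVert := fun _ => PUnit.unit
            Sigma := {2}
            sigma_prime := ⟨Set.singleton_nonempty 2,
              fun p hp => by rw [Set.mem_singleton_iff.mp hp]; exact Nat.prime_two⟩
            sigmaIndex := fun _ => 1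
            sigmaIndex_isSigmaInteger := fun _ =>
              ⟨Nat.one_pos, fun p hp hd => (hp.ne_one (Nat.dvd_one.mp hd)).elim⟩ },
    ?_, ⟨PUnit.unit⟩, ⟨PUnit.unit⟩, ⟨PUnit.unit⟩⟩
  change Finite PUnit.{u + 1}
  infer_instance

/-! ## The universal closures are false -/

/-- **F-0297 as a schema: `∀ X, X.Prop_1_3_i` is FALSE** (at the finite data of `exists_finite`).
The row is consumable only by name at given (geometric) data. [cite: MochizukiAbsTopII2013, Prop 1.3 (i) p.11] -/
theorem not_forall_prop_1_3_i :
    ¬ ∀ X : DPSCIndexData.{u},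
      Literature.AnabelianGeometry.AbsoluteAnabelian.AbsTopII.DPSCIndexData.Prop_1_3_i X := by
  obtain ⟨X, hfin, -, -, ⟨e⟩⟩ := exists_finite.{u}
  haveI := hfin
  exact fun h => X.not_prop_1_3_i_of_finite e (h X)

/-- **F-0298 as a schema: `∀ X, X.Prop_1_3_ii` is FALSE** (at the finite data of `exists_finite`).
The row is consumable only by name at given (geometric) data. [cite: MochizukiAbsTopII2013, Prop 1.3 (ii) p.11] -/
theorem not_forall_prop_1_3_ii :
    ¬ ∀ X : DPSCIndexData.{u},
      Literature.AnabelianGeometry.AbsoluteAnabelian.AbsTopII.DPSCIndexData.Prop_1_3_ii X := by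
  obtain ⟨X, hfin, -, ⟨e⟩, -⟩ := exists_finite.{u}
  haveI := hfin
  exact fun h => X.not_prop_1_3_ii_of_finite e (h X)

/-- **F-0299 as a schema: `∀ X, X.Prop_1_3_iii'` is FALSE** (at the finite data of `exists_finite`).
The row is consumable only by name at given (geometric) data, or through abc-iut-L4-t6's
`prop_1_3_iii'_of_inputs`. [cite: MochizukiAbsTopII2013, Prop 1.3 (iii) p.11] -/
theorem not_forall_prop_1_3_iii' :
    ¬ ∀ X : DPSCIndexData.{u},
      Literature.AnabelianGeometry.AbsoluteAnabelian.AbsTopII.DPSCIndexData.Prop_1_3_iii' X := by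
  obtain ⟨X, hfin, ⟨v⟩, -, -⟩ := exists_finite.{u}
  haveI := hfin
  exact fun h => X.not_prop_1_3_iii'_of_finite v (h X)

end Literature.AnabelianGeometry.AbsoluteAnabelian.AbsTopII.DPSCIndexData
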